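import Literature.IUT.HodgeTheaters.PuncturedEllipticCoveringsCor12HextOfCor33i
import Literature.AnabelianGeometry.AbsoluteAnabelian.NFGaloisTFGNormalCorollaries
import HarnessLib

/-!
# [IUTchI] Cor 1.2: the Cor 3.3 (i) binders `hext` / `hextC` re-keyed to FACT-LIST NAMES — «applicable in light of
# [AbsTopI], Example 4.8» (F-0193) and, over a number field, `GeomTFG` (F-0240 shape) — proof-only

S. Mochizuki, *Inter-universal Teichmüller theory I*, kurims manuscript (May 2020), §1, Cor 1.2 p. 39, proof l. 24–27:
«the algorithms of [AbsTopII], Corollary 3.3, (i), (ii) — which are applicable in light of [AbsTopI], Example 4.8 — allow one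
to reconstruct `Π_C`» [claim: Mochizuki2012, status: disputed] (D-0012 claim key; nothing of the series is asserted here);
S. Mochizuki, *Topics in Absolute Anabelian Geometry II*, Cor 3.3 (i) pp. 67–68 and Remark 3.3.1 p. 69 («if one takes `𝔽` to be
the set of isomorphism classes of generalized sub-`p`-adic fields [...] then `𝒟 := 𝕍 × 𝔽 × 𝕊` satisfies the hypothesis of
Corollary 3.3 concerning '`𝒟`' [cf. [AbsTopI], Example 4.8, (i)]») [cite: MochizukiAbsTopII2013, Rmk 3.3.1 p.69]; *Topics … I*,
Example 4.8 (i) p. 58 [cite: MochizukiAbsTopI2012, Ex 4.8 (i) p.58]; *The absolute anabelian geometry of hyperbolic curves*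
[AbsAnab], Lemma 1.1.4 (i) p. 7 («a formal consequence of Theorem 1.1.2») [cite: MochizukiAbsAnab2004, Lemma 1.1.4 (i) p.7].

PROOF-ONLY companion (abc-iut cell; L5 ROWS #6 row R42 «COR12-CHAIN-HYPS-CLASSIFY», seat abc-iut-w6-d032 gen 7; no `def`, no
`instance`).  The adapter `PuncturedEllipticCoveringsCor12HextOfCor33i.lean` (same seat, gen 6) derives the certificate binders
`hext`/`hextC` of `Summit.ABC.IUTFork.Conditional.layer5_held_cor12_v6` from [AbsTopII] Cor 3.3 (i) as typed in layer L4
(`AbsTopII.EllipticModel.Cor_3_3_i`, F-0294) PLUS the raw interface hypotheses of Cor 3.3: the `𝒟`-hypotheses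
`𝒟.IsChainFull` / `𝒟.RelIsomDGC` ([AbsTopI] Def 4.6) and the standing hypotheses `IsCor33Member` («`G` slim», «`χ_l` open for
some `l ∈ Σ`», …), and the Rmk 3.3.2 input `GeomIsMaxTFGNormalIn ⊤` ([AbsAnab] Lem 1.1.4 (i), F-0005 shape).  THIS FILE
classifies and RE-KEYS those binders exactly as print does:

* over a class `𝒟` of [AbsTopI] Example 4.8 (i) (`𝒟.IsEx48ClassGen p`: generalized sub-`p`-adic construction-data fields,
  `p ∈ Σ`, members = the hyperbolic orbicurves) the `𝒟`-hypotheses AND «`G` slim», «`χ_p` open» are the four clauses of the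
  named fact `𝒟.Ex_4_8_i p` (**F-0193**, BY NAME) — layer L4's `EllipticModel.isCor33Member_of_ex_4_8_i`; this is the
  (i)-sibling of L4's PROVED reductions `cor_3_3_iii_of_ex_4_8_i` / `cor_3_4_of_ex_4_8_i` ([AbsTopII] Rmk 3.3.1 as a lemma);
* at universe `0` over a construction-data field that is a NUMBER FIELD, `GeomIsMaxTFGNormalIn ⊤` at a member is a THEOREM
  from `GeomTFG` («`Δ` topologically finitely generated», [AbsTopI] Prop 2.2, F-0240 shape) by [AbsAnab] Thm 1.1.2 — discharged
  in the tree (`galoisNF_tfgNormalSubgroup_trivial_holds`) — through L4's `FundamentalExtension.geomIsMaxTFGNormalIn_of_nfBase`.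
  (Over an MLF base the predicate FAILS — L4's `MLFBase.not_geomIsMaxTFGNormalIn_of_tfg` — and [AbsTopI] Thm 2.6 (v) is the
  printed substitute; [IUTchI] Cor 1.2 is consumed at the NF-level data of [IUTchI] Def 3.1, so the NF form is the one that
  bears on the certificate.)

## BINDER CENSUS of `PuncturedEllipticData.hext_of_cor_3_3_i` (p494401) — classes and what decides them

| binder of p494401 | class | decided by (tree decl) | in THIS file |
|---|---|---|---|
| `hfull : 𝒟.IsChainFull` | FACT-INSTANCE (clause 1 of F-0193 at an Ex 4.8 (i) class); NOT derivable at the interface (`AbsTopI.ConstructionDataClass.exists_isEx48ClassGen_not_isChainFull`) — a structure law of the instantiated class («it is immediate that `𝒟` is chain-full», scheme side) | `ConstructionDataClass.ex_4_8_i_iff` | ⟸ `h𝒟 : 𝒟.IsEx48ClassGen p` + `hEx : 𝒟.Ex_4_8_i p` |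
| `hdgc : 𝒟.RelIsomDGC` | FACT-INSTANCE (clause 2 of F-0193; itself F-0197); on CURVE members a consequence of [Tpcs] Thm 4.12 field by field (`relIsomGC_curves_of_thm_4_12`, `relIsomDGC_of_relIsomGC`) | `ConstructionDataClass.ex_4_8_i_iff` | ⟸ `h𝒟` + `hEx` |
| `hX hX′ : M.IsCor33Member` | fields `slim`, `cyclotomic` = clauses 4, 3 of F-0193; fields `mem`, `ellipticallyAdmissible`, `geom_slim`, `geom_ne_bot` = MEMBER DATA (which object one realises) | `EllipticModel.isCor33Member_of_ex_4_8_i` | ⟸ `h𝒟` + `hEx` + `hmem hadm hΔ hne` |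
| `hmax hmax′ : GeomIsMaxTFGNormalIn ⊤` | NF base: DISCHARGEABLE from `GeomTFG` (F-0240 shape) — theorem; MLF base: FALSE as typed | `FundamentalExtension.geomIsMaxTFGNormalIn_of_nfBase` | `_nf` forms: ⟸ `[NumberField (𝒟.fld b)]` + `htfg : GeomTFG` |
| `hS` | DATA (same `Σ`; automatic when `b = b′`, and for `IsEx48ClassSub` where `Σ = Primes`) | — | kept |
| `h33 : M.Cor_3_3_i` | FACT-INSTANCE F-0294 BY NAME | — | kept |
| `ePi eC hcomp` (+ primed) | DATA (realisation of `Π_{X̲→} ⊆ Π_C`, resp. `Π_{C̲→} ⊆ Π_C`, by a model member and its `k`-core) | — | kept |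

Net effect: the residual of the Cor 1.2 binders `hext`/`hextC` reads «F-0294 + F-0193 BY NAME at a class of Example 4.8 (i) +
member data (`Mem`, `Π`-elliptically admissible, `Δ` slim, `Δ ≠ 1`, and over an NF `Δ` tfg) + realisation DATA»; no raw
interface law of [AbsTopI] Def 4.6 / [AbsTopII] Cor 3.3 is left as a binder.  HONEST FRAMING: binders are assumption labels;
no instance of `EllipticModel` over a genuine Example 4.8 class exists in the tree (layer L4 is model-relative); typed ≠ proved;
nothing here bears on [IUTchIII] Cor 3.12 or asserts that abc is proved or refuted.
-/

noncomputable section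

open CategoryTheory Topology
open scoped Pointwise

universe u v

namespace Literature.IUT.HodgeTheaters

open Literature.AlgebraicGeometry.Frobenioids (IsSlimGroup)
open Literature.AnabelianGeometry.AbsoluteAnabelian
open Literature.AnabelianGeometry.AbsoluteAnabelian.AbsTopI (ConstructionDataClass)
open Literature.AnabelianGeometry.AbsoluteAnabelian.AbsTopII (EllipticModel)

/-! ### [AbsTopII] Cor 3.3 (i) over a class of [AbsTopI] Example 4.8 (i): the (i)-sibling of L4's Rmk 3.3.1 reductions -/

/-- **[AbsTopII] Cor 3.3 (i) with Rmk 3.3.1** (PROVED reduction, the (i)-sibling of layer L4's `cor_3_3_iii_of_ex_4_8_i` /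
`cor_3_4_of_ex_4_8_i`): over a class of [AbsTopI] Example 4.8 (i), GIVEN the named facts `𝒟.Ex_4_8_i p` (F-0193) and
`M.Cor_3_3_i` (F-0294), the group-theoretic characterization of the `k`-core chain holds for every `Π`-elliptically admissible
member with slim nontrivial `Δ` — no `𝒟`-hypothesis, slimness of `G` or cyclotomic hypothesis remains.
[cite: MochizukiAbsTopII2013, Rmk 3.3.1 p.69] -/
theorem cor_3_3_i_of_ex_4_8_i {𝒟 : ConstructionDataClass.{u}} (M : EllipticModel 𝒟) {p : ℕ} [Fact p.Prime]
    (h𝒟 : 𝒟.IsEx48ClassGen p) (hEx : 𝒟.Ex_4_8_i p) (h33 : M.Cor_3_3_i) {b : 𝒟.Base} {X : (𝒟.datum b).Obj}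
    (hmem : 𝒟.Mem b X) (hadm : M.IsEllipticallyAdmissible b X) (hΔ : IsSlimGroup ((𝒟.datum b).ext X).geom)
    (hne : ((𝒟.datum b).ext X).geom ≠ ⊥) :
    ∃ c : ((𝒟.datum b).ext X).PiChain (M.cusps b X)
        (M.isCor33Member_of_ex_4_8_i h𝒟 hEx hmem hadm hΔ hne).arith_slim hΔ hne,
      AbsTopII.IsProSigmaChain (𝒟.datum b).primes c ∧ M.RealizesCore b X c ∧
        AbsTopII.IsEtLocTerminalFor (𝒟.datum b).primes c ∧
        ∀ c' : ((𝒟.datum b).ext X).PiChain (M.cusps b X)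
            (M.isCor33Member_of_ex_4_8_i h𝒟 hEx hmem hadm hΔ hne).arith_slim hΔ hne,
          AbsTopII.IsProSigmaChain (𝒟.datum b).primes c' → c'.typeChain = [ElemOpType.finEtQuot] →
            AbsTopII.IsEtLocTerminalFor (𝒟.datum b).primes c' → AbsTopII.LastTermsIsomorphic c' c :=
  h33 (hEx h𝒟).1 (hEx h𝒟).2.1 b X (M.isCor33Member_of_ex_4_8_i h𝒟 hEx hmem hadm hΔ hne)

/-- **[AbsTopII] Cor 3.3 (i), bi-anabelian form, over a class of [AbsTopI] Example 4.8 (i)**: GIVEN F-0193 `𝒟.Ex_4_8_i p` and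
F-0294 `M.Cor_3_3_i`, for two `Π`-elliptically admissible members (slim nontrivial `Δ`, same `Σ`) every isomorphism of
extensions `Φ : (Π_X ↠ G) ⥲ (Π_{X′} ↠ G′)` extends to the `k`-cores: `Θ : Π_C ⥲ Π_{C′}` with
`Θ ∘ (Π_X ↪ Π_C) = (Π_{X′} ↪ Π_{C′}) ∘ Φ` (layer L4's `exists_coreIso_extending_of_cor_3_3_i` with its `𝒟`-hypotheses and
standing hypotheses supplied by F-0193). [cite: MochizukiAbsTopII2013, Cor 3.3 (i) p.67] -/
theorem exists_coreIso_extending_of_ex_4_8_i {𝒟 : ConstructionDataClass.{u}} (M : EllipticModel 𝒟) {p : ℕ} [Fact p.Prime]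
    (h𝒟 : 𝒟.IsEx48ClassGen p) (hEx : 𝒟.Ex_4_8_i p) (h33 : M.Cor_3_3_i) {b b' : 𝒟.Base} {X : (𝒟.datum b).Obj}
    {X' : (𝒟.datum b').Obj} (hmem : 𝒟.Mem b X) (hadm : M.IsEllipticallyAdmissible b X)
    (hΔ : IsSlimGroup ((𝒟.datum b).ext X).geom) (hne : ((𝒟.datum b).ext X).geom ≠ ⊥) (hmem' : 𝒟.Mem b' X')
    (hadm' : M.IsEllipticallyAdmissible b' X') (hΔ' : IsSlimGroup ((𝒟.datum b').ext X').geom)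
    (hne' : ((𝒟.datum b').ext X').geom ≠ ⊥) (hS : (𝒟.datum b').primes = (𝒟.datum b).primes)
    (Φ : (𝒟.datum b).ext X ≅ (𝒟.datum b').ext X') :
    ∃ Θ : (M.coreExt b X).arith ≃ₜ* (M.coreExt b' X').arith,
      ∀ x, Θ ((M.toCore b X).arith x) = (M.toCore b' X').arith (Φ.hom.arith x) :=
  M.exists_coreIso_extending_of_cor_3_3_i h33 (hEx h𝒟).1 (hEx h𝒟).2.1
    (M.isCor33Member_of_ex_4_8_i h𝒟 hEx hmem hadm hΔ hne) (M.isCor33Member_of_ex_4_8_i h𝒟 hEx hmem' hadm' hΔ' hne') hS Φ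

/-! ### The generic adapter over a class of Example 4.8 (i) -/

/-- **[AbsTopII] Cor 3.3 (i) ⇒ the pure extension property for REALISED members, over a class of [AbsTopI] Example 4.8 (i)**:
as `exists_continuousMulEquiv_extending_of_cor_3_3_i`, with the `𝒟`-hypotheses and the standing hypotheses «`G` slim»,
«`χ_l` open» supplied BY NAME by F-0193 `𝒟.Ex_4_8_i p`; the members enter through their data (`Mem`, `Π`-elliptically
admissible, `Δ` slim, `Δ ≠ 1`), the Rmk 3.3.2 input `GeomIsMaxTFGNormalIn ⊤` and the realisation data stay.
[cite: MochizukiAbsTopII2013, Cor 3.3 (i) p.67] -/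
theorem exists_continuousMulEquiv_extending_of_ex_4_8_i
    {A : Type v} [Group A] [TopologicalSpace A] {A' : Type v} [Group A'] [TopologicalSpace A']
    {Q : Subgroup A} {Q' : Subgroup A'}
    {𝒟 : ConstructionDataClass.{u}} (M : EllipticModel 𝒟) {p : ℕ} [Fact p.Prime] (h𝒟 : 𝒟.IsEx48ClassGen p)
    (hEx : 𝒟.Ex_4_8_i p) (h33 : M.Cor_3_3_i) {b b' : 𝒟.Base} {X : (𝒟.datum b).Obj} {X' : (𝒟.datum b').Obj}
    (hmem : 𝒟.Mem b X) (hadm : M.IsEllipticallyAdmissible b X) (hΔ : IsSlimGroup ((𝒟.datum b).ext X).geom)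
    (hne : ((𝒟.datum b).ext X).geom ≠ ⊥) (hmem' : 𝒟.Mem b' X') (hadm' : M.IsEllipticallyAdmissible b' X')
    (hΔ' : IsSlimGroup ((𝒟.datum b').ext X').geom) (hne' : ((𝒟.datum b').ext X').geom ≠ ⊥)
    (hS : (𝒟.datum b').primes = (𝒟.datum b).primes)
    (hmax : ((𝒟.datum b).ext X).GeomIsMaxTFGNormalIn ⊤) (hmax' : ((𝒟.datum b').ext X').GeomIsMaxTFGNormalIn ⊤)
    (ePi : ((𝒟.datum b).ext X).arith ≃ₜ* Q) (eC : (M.coreExt b X).arith ≃ₜ* A)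
    (hcomp : ∀ x, eC ((M.toCore b X).arith x) = (ePi x : A))
    (ePi' : ((𝒟.datum b').ext X').arith ≃ₜ* Q') (eC' : (M.coreExt b' X').arith ≃ₜ* A')
    (hcomp' : ∀ x, eC' ((M.toCore b' X').arith x) = (ePi' x : A'))
    (φ : Q ≃* Q') (hφ : Continuous φ) (hφ' : Continuous φ.symm) :
    ∃ Θ : A ≃ₜ* A', ∀ x : Q, Θ (x : A) = (φ x : A') :=
  exists_continuousMulEquiv_extending_of_cor_3_3_i M h33 (hEx h𝒟).1 (hEx h𝒟).2.1
    (M.isCor33Member_of_ex_4_8_i h𝒟 hEx hmem hadm hΔ hne) (M.isCor33Member_of_ex_4_8_i h𝒟 hEx hmem' hadm' hΔ' hne') hS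
    hmax hmax' ePi eC hcomp ePi' eC' hcomp' φ hφ hφ'

/-! ### `GeomIsMaxTFGNormalIn ⊤` at a member over a number field (universe `0`) -/

/-- **[AbsAnab] Lemma 1.1.4 (i) at a member of a class of construction data over a NUMBER FIELD** (universe `0`): if the
construction-data field `k_b` is a number field and `Δ_X` is topologically finitely generated ([AbsTopI] Prop 2.2, `GeomTFG`),
then `Δ_X` is the maximal topologically finitely generated closed normal subgroup of `Π_X` — [AbsAnab] Thm 1.1.2 is discharged
in the tree, so this is a theorem (layer L4's `geomIsMaxTFGNormalIn_of_nfBase` at the base `k_b` itself, `G = G_{k_b}`).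
[cite: MochizukiAbsAnab2004, Lemma 1.1.4 (i) p.7] -/
theorem geomIsMaxTFGNormalIn_top_of_geomTFG_of_numberField {𝒟 : ConstructionDataClass.{0}} {b : 𝒟.Base}
    [NumberField (𝒟.fld b)] (X : (𝒟.datum b).Obj) (htfg : ((𝒟.datum b).ext X).GeomTFG) :
    ((𝒟.datum b).ext X).GeomIsMaxTFGNormalIn ⊤ := by
  refine FundamentalExtension.geomIsMaxTFGNormalIn_of_nfBase ((𝒟.datum b).ext X)
    { F := 𝒟.fld b, galIso := ContinuousMulEquiv.refl _ } htfg ⊤ ?_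
  rw [Subgroup.coe_top]
  exact isOpen_univ

/-! ### The literal certificate binders `hext`, `hextC` at the §1 data, re-keyed -/

namespace PuncturedEllipticData

variable {P P' : PuncturedEllipticData.{v}}

/-- **`hext` of the [IUTchI] Cor 1.2 certificate conjunct FROM F-0294 + F-0193 BY NAME**: if `Π_{X̲→} ⊆ Π_C`, `Π′_{X̲→} ⊆ Π′_C`
of two §1 data `P`, `P′` REALISE `Π`-elliptically admissible members `X`, `X′` (slim nontrivial `Δ`, same `Σ`) of a Cor 3.3 / 3.4
model `M` over a class `𝒟` of [AbsTopI] Example 4.8 (i) («applicable in light of [AbsTopI], Example 4.8», p. 39 l. 25), with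
their `k`-cores realised by `Π_C`, `Π′_C`, then — GIVEN F-0193 `𝒟.Ex_4_8_i p`, F-0294 `M.Cor_3_3_i` and `GeomIsMaxTFGNormalIn ⊤`
at the two members — every bicontinuous `φ : Π_{X̲→} ≃ Π′_{X̲→}` extends to `Θ : Π_C ≃ Π′_C` (the binder `hext` of
`Summit.ABC.IUTFork.Conditional.layer5_held_cor12_v6`, verbatim). ([IUTchI] Cor 1.2 p.39) [claim: Mochizuki2012, status: disputed] -/
theorem hext_of_ex_4_8_i {𝒟 : ConstructionDataClass.{u}} (M : EllipticModel 𝒟) {p : ℕ} [Fact p.Prime]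
    (h𝒟 : 𝒟.IsEx48ClassGen p) (hEx : 𝒟.Ex_4_8_i p) (h33 : M.Cor_3_3_i)
    {b b' : 𝒟.Base} {X : (𝒟.datum b).Obj} {X' : (𝒟.datum b').Obj}
    (hmem : 𝒟.Mem b X) (hadm : M.IsEllipticallyAdmissible b X) (hΔ : IsSlimGroup ((𝒟.datum b).ext X).geom)
    (hne : ((𝒟.datum b).ext X).geom ≠ ⊥) (hmem' : 𝒟.Mem b' X') (hadm' : M.IsEllipticallyAdmissible b' X')
    (hΔ' : IsSlimGroup ((𝒟.datum b').ext X').geom) (hne' : ((𝒟.datum b').ext X').geom ≠ ⊥)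
    (hS : (𝒟.datum b').primes = (𝒟.datum b).primes)
    (hmax : ((𝒟.datum b).ext X).GeomIsMaxTFGNormalIn ⊤) (hmax' : ((𝒟.datum b').ext X').GeomIsMaxTFGNormalIn ⊤)
    (ePi : ((𝒟.datum b).ext X).arith ≃ₜ* P.piXarrow) (eC : (M.coreExt b X).arith ≃ₜ* P.PiC)
    (hcomp : ∀ x, eC ((M.toCore b X).arith x) = (ePi x : P.PiC))
    (ePi' : ((𝒟.datum b').ext X').arith ≃ₜ* P'.piXarrow) (eC' : (M.coreExt b' X').arith ≃ₜ* P'.PiC)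
    (hcomp' : ∀ x, eC' ((M.toCore b' X').arith x) = (ePi' x : P'.PiC)) :
    ∀ φ : P.piXarrow ≃* P'.piXarrow, Continuous φ → Continuous φ.symm →
      ∃ Θ : P.PiC ≃ₜ* P'.PiC, ∀ x : P.piXarrow, Θ (x : P.PiC) = (φ x : P'.PiC) :=
  fun φ hφ hφ' =>
    exists_continuousMulEquiv_extending_of_ex_4_8_i M h𝒟 hEx h33 hmem hadm hΔ hne hmem' hadm' hΔ' hne' hS hmax hmax'
      ePi eC hcomp ePi' eC' hcomp' φ hφ hφ'

/-- **`hextC` of the [IUTchI] Cor 1.2 certificate conjunct FROM F-0294 + F-0193 BY NAME**: the resp'd binder, for realised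
members `C̲→_K`, `C̲→_{K′}` (`Π_{C̲→} ⊆ Π_C`; hyperbolic orbicurves are members of an Example 4.8 (i) class).
([IUTchI] Cor 1.2 p.39) [claim: Mochizuki2012, status: disputed] -/
theorem hextC_of_ex_4_8_i {𝒟 : ConstructionDataClass.{u}} (M : EllipticModel 𝒟) {p : ℕ} [Fact p.Prime]
    (h𝒟 : 𝒟.IsEx48ClassGen p) (hEx : 𝒟.Ex_4_8_i p) (h33 : M.Cor_3_3_i)
    {b b' : 𝒟.Base} {Y : (𝒟.datum b).Obj} {Y' : (𝒟.datum b').Obj}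
    (hmem : 𝒟.Mem b Y) (hadm : M.IsEllipticallyAdmissible b Y) (hΔ : IsSlimGroup ((𝒟.datum b).ext Y).geom)
    (hne : ((𝒟.datum b).ext Y).geom ≠ ⊥) (hmem' : 𝒟.Mem b' Y') (hadm' : M.IsEllipticallyAdmissible b' Y')
    (hΔ' : IsSlimGroup ((𝒟.datum b').ext Y').geom) (hne' : ((𝒟.datum b').ext Y').geom ≠ ⊥)
    (hS : (𝒟.datum b').primes = (𝒟.datum b).primes)
    (hmax : ((𝒟.datum b).ext Y).GeomIsMaxTFGNormalIn ⊤) (hmax' : ((𝒟.datum b').ext Y').GeomIsMaxTFGNormalIn ⊤)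
    (ePi : ((𝒟.datum b).ext Y).arith ≃ₜ* P.piCarrow) (eC : (M.coreExt b Y).arith ≃ₜ* P.PiC)
    (hcomp : ∀ x, eC ((M.toCore b Y).arith x) = (ePi x : P.PiC))
    (ePi' : ((𝒟.datum b').ext Y').arith ≃ₜ* P'.piCarrow) (eC' : (M.coreExt b' Y').arith ≃ₜ* P'.PiC)
    (hcomp' : ∀ x, eC' ((M.toCore b' Y').arith x) = (ePi' x : P'.PiC)) :
    ∀ ψ : P.piCarrow ≃* P'.piCarrow, Continuous ψ → Continuous ψ.symm →
      ∃ Θ : P.PiC ≃ₜ* P'.PiC, ∀ x : P.piCarrow, Θ (x : P.PiC) = (ψ x : P'.PiC) :=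
  fun ψ hψ hψ' =>
    exists_continuousMulEquiv_extending_of_ex_4_8_i M h𝒟 hEx h33 hmem hadm hΔ hne hmem' hadm' hΔ' hne' hS hmax hmax'
      ePi eC hcomp ePi' eC' hcomp' ψ hψ hψ'

/-! ### Over a NUMBER-FIELD construction-data field (universe `0`): `hmax` from `GeomTFG` -/

/-- **`hext` of the [IUTchI] Cor 1.2 certificate conjunct, NF form** (universe `0`): as `hext_of_ex_4_8_i`, with the two
construction-data fields NUMBER FIELDS (the case of [IUTchI] §1 / Def 3.1, `K` an NF — a sub-`p`-adic, hence generalized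
sub-`p`-adic, field) and the Rmk 3.3.2 inputs `GeomIsMaxTFGNormalIn ⊤` DISCHARGED from «`Δ` topologically finitely generated»
(`GeomTFG`, [AbsTopI] Prop 2.2 / F-0240 shape) by [AbsAnab] Thm 1.1.2 (tree theorem).  Residual: F-0193 + F-0294 BY NAME, member
data (`Mem`, `Π`-elliptically admissible, `Δ` slim, `Δ ≠ 1`, `Δ` tfg), same `Σ`, realisation DATA.
([IUTchI] Cor 1.2 p.39) [claim: Mochizuki2012, status: disputed] -/
theorem hext_of_ex_4_8_i_nf {𝒟 : ConstructionDataClass.{0}} (M : EllipticModel 𝒟) {p : ℕ} [Fact p.Prime]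
    (h𝒟 : 𝒟.IsEx48ClassGen p) (hEx : 𝒟.Ex_4_8_i p) (h33 : M.Cor_3_3_i)
    {b b' : 𝒟.Base} [NumberField (𝒟.fld b)] [NumberField (𝒟.fld b')] {X : (𝒟.datum b).Obj} {X' : (𝒟.datum b').Obj}
    (hmem : 𝒟.Mem b X) (hadm : M.IsEllipticallyAdmissible b X) (hΔ : IsSlimGroup ((𝒟.datum b).ext X).geom)
    (hne : ((𝒟.datum b).ext X).geom ≠ ⊥) (htfg : ((𝒟.datum b).ext X).GeomTFG)
    (hmem' : 𝒟.Mem b' X') (hadm' : M.IsEllipticallyAdmissible b' X') (hΔ' : IsSlimGroup ((𝒟.datum b').ext X').geom)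
    (hne' : ((𝒟.datum b').ext X').geom ≠ ⊥) (htfg' : ((𝒟.datum b').ext X').GeomTFG)
    (hS : (𝒟.datum b').primes = (𝒟.datum b).primes)
    (ePi : ((𝒟.datum b).ext X).arith ≃ₜ* P.piXarrow) (eC : (M.coreExt b X).arith ≃ₜ* P.PiC)
    (hcomp : ∀ x, eC ((M.toCore b X).arith x) = (ePi x : P.PiC))
    (ePi' : ((𝒟.datum b').ext X').arith ≃ₜ* P'.piXarrow) (eC' : (M.coreExt b' X').arith ≃ₜ* P'.PiC)
    (hcomp' : ∀ x, eC' ((M.toCore b' X').arith x) = (ePi' x : P'.PiC)) :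
    ∀ φ : P.piXarrow ≃* P'.piXarrow, Continuous φ → Continuous φ.symm →
      ∃ Θ : P.PiC ≃ₜ* P'.PiC, ∀ x : P.piXarrow, Θ (x : P.PiC) = (φ x : P'.PiC) :=
  hext_of_ex_4_8_i M h𝒟 hEx h33 hmem hadm hΔ hne hmem' hadm' hΔ' hne' hS
    (geomIsMaxTFGNormalIn_top_of_geomTFG_of_numberField X htfg)
    (geomIsMaxTFGNormalIn_top_of_geomTFG_of_numberField X' htfg') ePi eC hcomp ePi' eC' hcomp'

/-- **`hextC` of the [IUTchI] Cor 1.2 certificate conjunct, NF form** (universe `0`): the resp'd binder for realised members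
`C̲→_K`, `C̲→_{K′}` over number fields, `hmax` discharged from `GeomTFG`.
([IUTchI] Cor 1.2 p.39) [claim: Mochizuki2012, status: disputed] -/
theorem hextC_of_ex_4_8_i_nf {𝒟 : ConstructionDataClass.{0}} (M : EllipticModel 𝒟) {p : ℕ} [Fact p.Prime]
    (h𝒟 : 𝒟.IsEx48ClassGen p) (hEx : 𝒟.Ex_4_8_i p) (h33 : M.Cor_3_3_i)
    {b b' : 𝒟.Base} [NumberField (𝒟.fld b)] [NumberField (𝒟.fld b')] {Y : (𝒟.datum b).Obj} {Y' : (𝒟.datum b').Obj}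
    (hmem : 𝒟.Mem b Y) (hadm : M.IsEllipticallyAdmissible b Y) (hΔ : IsSlimGroup ((𝒟.datum b).ext Y).geom)
    (hne : ((𝒟.datum b).ext Y).geom ≠ ⊥) (htfg : ((𝒟.datum b).ext Y).GeomTFG)
    (hmem' : 𝒟.Mem b' Y') (hadm' : M.IsEllipticallyAdmissible b' Y') (hΔ' : IsSlimGroup ((𝒟.datum b').ext Y').geom)
    (hne' : ((𝒟.datum b').ext Y').geom ≠ ⊥) (htfg' : ((𝒟.datum b').ext Y').GeomTFG)
    (hS : (𝒟.datum b').primes = (𝒟.datum b).primes)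
    (ePi : ((𝒟.datum b).ext Y).arith ≃ₜ* P.piCarrow) (eC : (M.coreExt b Y).arith ≃ₜ* P.PiC)
    (hcomp : ∀ x, eC ((M.toCore b Y).arith x) = (ePi x : P.PiC))
    (ePi' : ((𝒟.datum b').ext Y').arith ≃ₜ* P'.piCarrow) (eC' : (M.coreExt b' Y').arith ≃ₜ* P'.PiC)
    (hcomp' : ∀ x, eC' ((M.toCore b' Y').arith x) = (ePi' x : P'.PiC)) :
    ∀ ψ : P.piCarrow ≃* P'.piCarrow, Continuous ψ → Continuous ψ.symm →
      ∃ Θ : P.PiC ≃ₜ* P'.PiC, ∀ x : P.piCarrow, Θ (x : P.PiC) = (ψ x : P'.PiC) :=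
  hextC_of_ex_4_8_i M h𝒟 hEx h33 hmem hadm hΔ hne hmem' hadm' hΔ' hne' hS
    (geomIsMaxTFGNormalIn_top_of_geomTFG_of_numberField Y htfg)
    (geomIsMaxTFGNormalIn_top_of_geomTFG_of_numberField Y' htfg') ePi eC hcomp ePi' eC' hcomp'

end PuncturedEllipticData

end Literature.IUT.HodgeTheaters

end
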